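import Mathlib.GroupTheory.Schreier
import Mathlib.GroupTheory.Index
import Literature.GroupTheory.CombinatorialGroupTheory.FreeGroupSubgroupSeparable
import HarnessLib

/-!
# A finitely generated profinitely dense subgroup of a virtually free group is everything

M. Hall's subgroup separability of free groups (Lyndon–Schupp, *Combinatorial Group Theory*,
Ch. I Prop. 3.10; tree: `FreeGroupSubgroupSeparable.eq_top_of_fg_of_forall_sup_eq_top`) says that a
finitely generated subgroup `H` of a free group `F` with `H P = F` for every normal subgroup `P` of
finite index is all of `F`.  This file extends the statement to VIRTUALLY free groups `G` (groups
with a free normal subgroup `N` of finite index): a finitely generated `H ≤ G` with `H ⊔ P = ⊤` for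
every normal finite-index `P ≤ G` equals `G` (`eq_top_of_fg_of_forall_sup_eq_top_of_virtuallyFree`).
Proof: `H ∩ N` is finitely generated (Schreier) and profinitely dense in `N` (normal cores), hence
equals `N` by the free case; then `H ⊇ N` and `H N = G`.  [cite: LyndonSchupp2001, Ch. I Prop. 3.10]

Used in the abc-iut cell for [SemiAnbd] Lemma 6.3 (ii) (Mochizuki, *Semi-graphs of anabelioids*,
p. 70: subgroups of DFG-type of a tempered fundamental group are of DOF-type), whose printed proof
applies Lemma 6.3 (i) (the free case) to the virtually free discrete quotients of `Π^temp`.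
Classical; nothing here concerns the disputed parts of inter-universal Teichmüller theory.
-/

namespace Literature.GroupTheory.CombinatorialGroupTheory

namespace VirtuallyFree

universe u v

variable {G : Type u} [Group G]

/-- If `H ⊔ P = ⊤` with `P` normal and `P ≤ N`, then every element of `N` is `h * p` with
`h ∈ H ⊓ N`, `p ∈ P`. [folklore] -/
private theorem mem_inf_mul_of_sup_eq_top {H P N : Subgroup G} [P.Normal] (hPN : P ≤ N)
    (h : H ⊔ P = ⊤) (n : G) (hn : n ∈ N) : ∃ x ∈ H ⊓ N, ∃ p ∈ P, x * p = n := by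
  have hn' : n ∈ ((H ⊔ P : Subgroup G) : Set G) := by rw [h]; exact Subgroup.mem_top n
  rw [Subgroup.mul_normal] at hn'
  obtain ⟨x, hx, p, hp, rfl⟩ := Set.mem_mul.mp hn'
  refine ⟨x, ⟨hx, ?_⟩, p, hp, rfl⟩
  have : x * p * p⁻¹ ∈ N := N.mul_mem hn (N.inv_mem (hPN hp))
  simpa using this

/-- **A finitely generated, profinitely dense subgroup of a virtually free group is everything.**
Let `N ⊴ G` be a normal subgroup of finite index isomorphic to a free group, `H ≤ G` finitely
generated with `H ⊔ P = ⊤` for every normal subgroup `P ≤ G` of finite index.  Then `H = ⊤`.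
(M. Hall's separability for the free group `N`, applied to `H ∩ N`, plus normal cores.)
[cite: LyndonSchupp2001, Ch. I Prop. 3.10] -/
theorem eq_top_of_fg_of_forall_sup_eq_top_of_virtuallyFree (N : Subgroup G) [N.Normal]
    [N.FiniteIndex] {α : Type v} (e : N ≃* FreeGroup α) (H : Subgroup G) (hH : H.FG)
    (h : ∀ P : Subgroup G, P.Normal → P.FiniteIndex → H ⊔ P = ⊤) : H = ⊤ := by
  classical
  -- `K = H ∩ N` viewed inside `N`, and its image `K'` in the free group
  let K : Subgroup N := H.subgroupOf N
  let K' : Subgroup (FreeGroup α) := K.map e.toMonoidHom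
  -- (1) `K` is finitely generated: it is a finite-index subgroup of the f.g. group `H`
  have hKfg : K.FG := by
    haveI : Group.FG H := (Group.fg_iff_subgroup_fg H).mpr hH
    -- `N ∩ H` inside `H` has finite index, hence is finitely generated (Schreier)
    haveI : Group.FG (N.subgroupOf H) := Subgroup.fg_of_index_ne_zero _
    -- transport along `N.subgroupOf H ≃* H ⊓ N ≃* H.subgroupOf N`
    have hK_eq : K = (H ⊓ N).subgroupOf N := by
      ext x; simp [K, Subgroup.mem_subgroupOf]
    let e₂ : (H ⊓ N : Subgroup G) ≃* (H ⊓ N).subgroupOf N :=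
      (Subgroup.subgroupOfEquivOfLe (inf_le_right : H ⊓ N ≤ N)).symm
    have hNH : N.subgroupOf H = (H ⊓ N).subgroupOf H := by
      ext x; simp [Subgroup.mem_subgroupOf]
    let e₀ : N.subgroupOf H ≃* (H ⊓ N : Subgroup G) :=
      (MulEquiv.subgroupCongr hNH).trans (Subgroup.subgroupOfEquivOfLe (inf_le_left : H ⊓ N ≤ H))
    haveI : Group.FG ((H ⊓ N).subgroupOf N) :=
      Group.fg_of_surjective (f := (e₂.toMonoidHom.comp e₀.toMonoidHom))
        (e₂.surjective.comp e₀.surjective)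
    rw [hK_eq]
    exact (Group.fg_iff_subgroup_fg _).mp inferInstance
  have hK'fg : K'.FG := fg_map_of_fg e.toMonoidHom hKfg
  -- (2) `K'` is profinitely dense in the free group
  have hK'dense : ∀ P' : Subgroup (FreeGroup α), P'.Normal → P'.FiniteIndex → K' ⊔ P' = ⊤ := by
    intro P' hP'n hP'f
    -- pull `P'` back to `N`, push into `G`, and take the normal core
    let Q : Subgroup N := P'.comap e.toMonoidHom
    haveI : Q.FiniteIndex := by
      refine ⟨?_⟩
      rw [Subgroup.index_comap_of_surjective _ e.surjective]
      exact hP'f.index_ne_zero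
    let P₀ : Subgroup G := Q.map N.subtype
    haveI : P₀.FiniteIndex := by
      refine ⟨?_⟩
      rw [Subgroup.index_map_subtype]
      exact mul_ne_zero Subgroup.FiniteIndex.index_ne_zero Subgroup.FiniteIndex.index_ne_zero
    let P : Subgroup G := P₀.normalCore
    have hPP₀ : P ≤ P₀ := Subgroup.normalCore_le P₀
    have hP₀N : P₀ ≤ N := fun x hx => by
      obtain ⟨y, -, rfl⟩ := hx; exact y.2
    have hHP := h P (Subgroup.normalCore_normal P₀) inferInstance
    -- every `n ∈ N` is `x * p` with `x ∈ H ∩ N`, `p ∈ P ≤ P₀`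
    refine top_le_iff.mp fun z _ => ?_
    obtain ⟨n, rfl⟩ := e.surjective z
    obtain ⟨x, hx, p, hp, hxp⟩ := mem_inf_mul_of_sup_eq_top (hPP₀.trans hP₀N) hHP n n.2
    have hpN : p ∈ N := hP₀N (hPP₀ hp)
    have hxK : (⟨x, hx.2⟩ : N) ∈ K := by simpa [K, Subgroup.mem_subgroupOf] using hx.1
    have hpQ : (⟨p, hpN⟩ : N) ∈ Q := by
      have hp₀ : p ∈ P₀ := hPP₀ hp
      obtain ⟨y, hy, hyp⟩ := hp₀
      have : y = ⟨p, hpN⟩ := Subtype.ext (by simpa using hyp)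
      exact this ▸ hy
    have hn : n = ⟨x, hx.2⟩ * ⟨p, hpN⟩ := Subtype.ext (by simpa using hxp.symm)
    rw [hn, map_mul]
    refine Subgroup.mul_mem _ (Subgroup.mem_sup_left ⟨_, hxK, rfl⟩) (Subgroup.mem_sup_right ?_)
    simpa [Q] using hpQ
  -- (3) hence `K' = ⊤`, so `N ≤ H`
  have hK'top : K' = ⊤ := eq_top_of_fg_of_forall_sup_eq_top K' hK'fg hK'dense
  have hNH : N ≤ H := by
    intro n hn
    have : e ⟨n, hn⟩ ∈ K' := by rw [hK'top]; exact Subgroup.mem_top _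
    obtain ⟨y, hy, hye⟩ := this
    have hyn : y = ⟨n, hn⟩ := e.injective hye
    have : (y : G) ∈ H := by simpa [K, Subgroup.mem_subgroupOf] using hy
    simpa [hyn] using this
  -- (4) and `H ⊔ N = ⊤` finishes
  have := h N inferInstance inferInstance
  rwa [sup_eq_left.mpr hNH] at this

end VirtuallyFree

end Literature.GroupTheory.CombinatorialGroupTheory
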